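import Literature.ComputerArithmetic.BoldoMuller2011.ErrFmaAppr
import Literature.ComputerArithmetic.Shewchuk1997.ExpansionArithmetic
import Mathlib.Tactic.Linarith
import Mathlib.Tactic.Positivity
import Mathlib.Tactic.Ring
import Mathlib.Tactic.FieldSimp
import Mathlib.Tactic.NormNum

/-!
# Shewchuk 1997, §4.3: the floating-point filter of ORIENT2D (stage A) and its error bound

J. R. Shewchuk, *Adaptive precision floating-point arithmetic and fast robust geometric predicates*,
Discrete Comput. Geom. 18 (1997) 305–363, §4.3 "ORIENT2D", pp. 345–349 (derivation of the error
bound for the approximation `A`, p. 348; Table 1, p. 349) and the public-domain `predicates.c`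
(function `orient2d`, constant `ccwerrboundA = (3.0 + 16.0 * epsilon) * epsilon`).

THE RESULT.  With `t₁ = a_x − c_x, t₂ = b_y − c_y, t₃ = a_y − c_y, t₄ = b_x − c_x`,
`x_i = ` the rounded `t_i`, `x₅ = x₁ ⊗ x₂`, `x₆ = x₃ ⊗ x₄` and `A = x₅ ⊖ x₆` (the ordinary
floating-point evaluation of the orientation determinant `t_A = t₁t₂ − t₃t₄`), the paper shows
(p. 348) `t₅ = x₅ ± (3ε + 3ε² + ε³)|x₅|`, `t₆` likewise, `t_A = A ± ε|A| ± (3ε + 3ε² + ε³)(|x₅| + |x₆|)`,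
and concludes that the sign of `A` is certainly the sign of `t_A` as soon as
`|A| ≥ (3ε + 16ε²) ⊗ (|x₅| ⊕ |x₆|)` (Table 1, line A; `ε = 2^−p` for round-to-nearest, the factor
`(1 + ε)²` absorbing the two roundings of the bound itself and `3ε + 16ε²` being the next `p`-bit
number above the needed coefficient).  The C function `orient2d` evaluates exactly this test
(after two short-cuts when `x₅` and `x₆` have opposite signs or `x₅ = 0`) and otherwise falls
through to the adaptive stages B–D (`orient2dadapt`).

THIS FILE types stage A as the function `orient2dStageA fl K` (`some det` = the filter returns
`det`, `none` = fall through) and proves `orient2dStageA_correct`: for `p ≥ 4`, ANY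
round-to-nearest `fl` (any tie rule), `K = ccwerrboundA p = (3 + 16ε)ε`, and input coordinates in a
format `F(p, e₀)` coarse enough that no operation of stage A underflows inexactly
(`emin ≤ e₀`, `emin + 2p ≤ 2e₀`; binary64: coordinates that are multiples of `2^−484`), whenever
stage A returns `det`, `det > 0 ↔ t_A > 0` and `det < 0 ↔ t_A < 0`.  The heart is the abstract
inequality `stageA_sign_of_bounds` (p. 348 verbatim: relative errors w.r.t. the COMPUTED values for
the seven operations of `A`, w.r.t. the true values for the two operations of the bound) — valid for
every `0 < ε ≤ 1/16`, which is where `p ≥ 4` enters.  Overflow is not modelled (as everywhere in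
this library).  Stages B–D are treated in `Summits/Ventures/CertifiedArithmetic/Expansions/`
(`Orient2d.lean`, `Orient2dPredicates.lean`: the exact stage D decides the sign on its own).
-/

namespace Literature.ComputerArithmetic.Shewchuk1997

open Literature.ComputerArithmetic.JeannerodRump2018
open Literature.ComputerArithmetic.BoldoJeannerodMelquiondMuller2023
open Literature.ComputerArithmetic.JeannerodLouvetMuller2013

variable {p : ℕ} {emin : ℤ} {fl : ℚ → ℚ}

/-! ## Grids and the two forms of the relative error bound -/

/-- Products of grid values: `2^s ℤ · 2^s' ℤ ⊆ 2^(s+s') ℤ`. [cite: Shewchuk1997, §2.1 p. 308 (model)] -/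
theorem OnGrid.mul {s s' : ℤ} {a b : ℚ} (ha : OnGrid s a) (hb : OnGrid s' b) :
    OnGrid (s + s') (a * b) := by
  obtain ⟨r, rfl⟩ := ha
  obtain ⟨r', rfl⟩ := hb
  exact ⟨r * r', by push_cast; rw [zpow_add₀ (by norm_num : (2 : ℚ) ≠ 0)]; ring⟩

/-- "`t = x ± ε|t|`": the roundoff of a value on a grid `2^k ℤ`, `k ≥ emin` (hence a float or a
normal number) is at most `ε = 2^−p` times the TRUE value, for any round-to-nearest.
[cite: Shewchuk1997, §4.3 p. 348] -/
theorem abs_sub_fl_le_eps_mul_abs (hp : 1 ≤ p) (hfl : IsRoundNearest p emin fl) {k : ℤ}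
    (hk : emin ≤ k) {t : ℚ} (ht : OnGrid k t) : |t - fl t| ≤ unitRoundoff p * |t| := by
  obtain ⟨r, hr⟩ := ht
  exact abs_sub_fl_le_u_of_mul_zpow hp hfl hk hr

/-- "`t = x ± ε|x|`": the roundoff of a value on a grid `2^k ℤ`, `k ≥ emin`, is at most `ε = 2^−p`
times the COMPUTED value, for any round-to-nearest (if `t` is not itself a float then
`|t| > 2^(p+k)`, so `|fl t| ≥ 2^(p+k)` is normal and half an ulp of it is `≤ ε|fl t|`).
[cite: Shewchuk1997, §4.3 p. 348] -/
theorem abs_sub_fl_le_eps_mul_abs_fl (hp : 1 ≤ p) (hfl : IsRoundNearest p emin fl) {k : ℤ}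
    (hk : emin ≤ k) {t : ℚ} (ht : OnGrid k t) : |t - fl t| ≤ unitRoundoff p * |fl t| := by
  obtain ⟨r, hr⟩ := ht
  by_cases hr' : |(r : ℚ)| ≤ 2 ^ p
  · rw [fl_eq_self hfl (isFloat_of_abs_le_two_pow hp hk hr hr'), sub_self, abs_zero]
    exact mul_nonneg (by unfold unitRoundoff; positivity) (abs_nonneg _)
  · refine BoldoMuller2011.abs_sub_fl_le_u_mul_abs_fl hp hfl hk hr (Or.inr ?_)
    have hlt : (2 : ℚ) ^ p < |(r : ℚ)| := not_le.mp hr'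
    have h2k : (0 : ℚ) < (2 : ℚ) ^ k := zpow_pos (by norm_num) k
    have hf : IsFloat p emin ((2 : ℚ) ^ p * (2 : ℚ) ^ k) := isFloat_two_pow_mul_zpow hp hk
    have h1 : |(2 : ℚ) ^ p * (2 : ℚ) ^ k| ≤ |t| := by
      rw [hr, abs_mul, abs_mul, abs_of_pos h2k, abs_of_pos (by positivity : (0 : ℚ) < 2 ^ p)]
      exact mul_le_mul_of_nonneg_right hlt.le h2k.le
    have h2 := abs_le_abs_fl hfl hf h1
    calc (2 : ℚ) ^ (emin + p - 1) ≤ (2 : ℚ) ^ ((p : ℤ) + k) :=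
          zpow_le_zpow_right₀ (by norm_num) (by omega)
      _ = (2 : ℚ) ^ p * (2 : ℚ) ^ k := by rw [zpow_add₀ (by norm_num), zpow_natCast]
      _ = |(2 : ℚ) ^ p * (2 : ℚ) ^ k| := (abs_of_pos (by positivity)).symm
      _ ≤ |fl t| := h2

/-- Rounding a grid value (`2^k ℤ`, `k ≥ emin`) preserves its sign strictly: `0 < fl t ↔ 0 < t`.
[cite: Shewchuk1997, §4.3 p. 346 (Fig. 21, stage A)] -/
theorem fl_pos_iff_of_onGrid (hp : 1 ≤ p) (hfl : IsRoundNearest p emin fl) {k : ℤ} (hk : emin ≤ k)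
    {t : ℚ} (ht : OnGrid k t) : 0 < fl t ↔ 0 < t := by
  obtain ⟨r, hr⟩ := ht
  constructor
  · intro h
    by_contra hle
    have : fl t ≤ fl 0 := fl_mono hfl (not_lt.mp hle)
    rw [fl_zero hfl] at this
    exact absurd h (not_lt.mpr this)
  · intro h
    rcases (fl_nonneg hfl h.le).lt_or_eq with hlt | heq
    · exact hlt
    · exfalso
      have := BoldoMuller2011.eq_zero_of_fl_eq_zero hp hfl hk hr heq.symm
      rw [this] at h
      exact lt_irrefl _ h

/-- Rounding a grid value (`2^k ℤ`, `k ≥ emin`) preserves its sign strictly: `fl t < 0 ↔ t < 0`.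
[cite: Shewchuk1997, §4.3 p. 346 (Fig. 21, stage A)] -/
theorem fl_neg_iff_of_onGrid (hp : 1 ≤ p) (hfl : IsRoundNearest p emin fl) {k : ℤ} (hk : emin ≤ k)
    {t : ℚ} (ht : OnGrid k t) : fl t < 0 ↔ t < 0 := by
  obtain ⟨r, hr⟩ := ht
  constructor
  · intro h
    by_contra hle
    have : fl 0 ≤ fl t := fl_mono hfl (not_lt.mp hle)
    rw [fl_zero hfl] at this
    exact absurd h (not_lt.mpr this)
  · intro h
    have h0 : fl t ≤ 0 := by
      have := fl_mono hfl h.le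
      rwa [fl_zero hfl] at this
    rcases h0.lt_or_eq with hlt | heq
    · exact hlt
    · exfalso
      have := BoldoMuller2011.eq_zero_of_fl_eq_zero hp hfl hk hr heq
      rw [this] at h
      exact lt_irrefl _ h

/-- A grid value (`2^k ℤ`, `k ≥ emin`) rounds to zero only if it is zero: `fl t = 0 ↔ t = 0`.
[cite: Shewchuk1997, §4.3 p. 346 (Fig. 21, stage A)] -/
theorem fl_eq_zero_iff_of_onGrid (hp : 1 ≤ p) (hfl : IsRoundNearest p emin fl) {k : ℤ}
    (hk : emin ≤ k) {t : ℚ} (ht : OnGrid k t) : fl t = 0 ↔ t = 0 := by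
  obtain ⟨r, hr⟩ := ht
  refine ⟨fun h => BoldoMuller2011.eq_zero_of_fl_eq_zero hp hfl hk hr h, ?_⟩
  rintro rfl
  exact fl_zero hfl

/-! ## The error analysis of p. 348 -/

/-- **The product step** (p. 348): from `t₁ = x₁ ± ε|x₁|`, `t₂ = x₂ ± ε|x₂|` and
`x₁x₂ = x₅ ± ε|x₅|` it follows that `t₅ = t₁t₂ = x₁x₂ ± (2ε + ε²)|x₁x₂| = x₅ ± (3ε + 3ε² + ε³)|x₅|`.
[cite: Shewchuk1997, §4.3 p. 348] -/
theorem abs_mul_sub_le_of_rel {u t₁ t₂ x₁ x₂ x₅ : ℚ} (hu : 0 ≤ u) (h₁ : |t₁ - x₁| ≤ u * |x₁|)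
    (h₂ : |t₂ - x₂| ≤ u * |x₂|) (h₅ : |x₁ * x₂ - x₅| ≤ u * |x₅|) :
    |t₁ * t₂ - x₅| ≤ (3 * u + 3 * u ^ 2 + u ^ 3) * |x₅| := by
  have ht₂ : |t₂| ≤ (1 + u) * |x₂| := by
    have := abs_sub_abs_le_abs_sub t₂ x₂
    linarith
  have hP : |x₁ * x₂| ≤ (1 + u) * |x₅| := by
    have := abs_sub_abs_le_abs_sub (x₁ * x₂) x₅
    linarith
  have hdec : t₁ * t₂ - x₁ * x₂ = (t₁ - x₁) * t₂ + x₁ * (t₂ - x₂) := by ring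
  have h1 : |t₁ * t₂ - x₁ * x₂| ≤ (2 * u + u ^ 2) * |x₁ * x₂| := by
    rw [hdec]
    calc |(t₁ - x₁) * t₂ + x₁ * (t₂ - x₂)| ≤ |(t₁ - x₁) * t₂| + |x₁ * (t₂ - x₂)| := abs_add_le _ _
      _ = |t₁ - x₁| * |t₂| + |x₁| * |t₂ - x₂| := by rw [abs_mul, abs_mul]
      _ ≤ u * |x₁| * ((1 + u) * |x₂|) + |x₁| * (u * |x₂|) :=
          add_le_add (mul_le_mul h₁ ht₂ (abs_nonneg _) (by positivity))
            (mul_le_mul_of_nonneg_left h₂ (abs_nonneg _))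
      _ = (2 * u + u ^ 2) * |x₁ * x₂| := by rw [abs_mul]; ring
  have h2 : (2 * u + u ^ 2) * |x₁ * x₂| ≤ (2 * u + u ^ 2) * ((1 + u) * |x₅|) :=
    mul_le_mul_of_nonneg_left hP (by positivity)
  calc |t₁ * t₂ - x₅| = |(t₁ * t₂ - x₁ * x₂) + (x₁ * x₂ - x₅)| := by ring_nf
    _ ≤ |t₁ * t₂ - x₁ * x₂| + |x₁ * x₂ - x₅| := abs_add_le _ _
    _ ≤ (2 * u + u ^ 2) * ((1 + u) * |x₅|) + u * |x₅| := add_le_add (h1.trans h2) h₅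
    _ = (3 * u + 3 * u ^ 2 + u ^ 3) * |x₅| := by ring

/-- **The sign test of stage A is sound** (p. 348 and Table 1, line A), as an inequality between
rationals: let `0 < ε ≤ 1/16`; if `t_i = x_i ± ε|x_i|` (`i = 1..4`), `x₁x₂ = x₅ ± ε|x₅|`,
`x₃x₄ = x₆ ± ε|x₆|`, `x₅ − x₆ = A ± ε|A|`, the computed bound satisfies
`|x₅| + |x₆| = S ± ε(|x₅| + |x₆|)` and `(3ε + 16ε²)S = E ± ε(3ε + 16ε²)S`, and the test `|A| ≥ E`
passes while `|x₅| + |x₆| > 0`, then `A` has the sign of `t_A = t₁t₂ − t₃t₄` (strictly, both ways).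
The margin is `(1 − ε)³(3 + 16ε) − (3 + 3ε + ε²) = 4 − 40ε + 45ε² − 16ε³ > 0`.
[cite: Shewchuk1997, §4.3 p. 348 and Table 1 p. 349] -/
theorem stageA_sign_of_bounds {u t₁ t₂ t₃ t₄ x₁ x₂ x₃ x₄ x₅ x₆ A S E : ℚ} (hu0 : 0 < u)
    (hu : u ≤ 1 / 16) (h₁ : |t₁ - x₁| ≤ u * |x₁|) (h₂ : |t₂ - x₂| ≤ u * |x₂|)
    (h₃ : |t₃ - x₃| ≤ u * |x₃|) (h₄ : |t₄ - x₄| ≤ u * |x₄|) (h₅ : |x₁ * x₂ - x₅| ≤ u * |x₅|)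
    (h₆ : |x₃ * x₄ - x₆| ≤ u * |x₆|) (hA : |(x₅ - x₆) - A| ≤ u * |A|)
    (hS : |(|x₅| + |x₆|) - S| ≤ u * (|x₅| + |x₆|))
    (hE : |(3 + 16 * u) * u * S - E| ≤ u * ((3 + 16 * u) * u * S)) (hs : 0 < |x₅| + |x₆|)
    (htest : E ≤ |A|) :
    (0 < A ↔ 0 < t₁ * t₂ - t₃ * t₄) ∧ (A < 0 ↔ t₁ * t₂ - t₃ * t₄ < 0) := by
  set s := |x₅| + |x₆| with hs_def
  set c := 3 * u + 3 * u ^ 2 + u ^ 3 with hc_def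
  set K := (3 + 16 * u) * u with hK_def
  have hK0 : 0 ≤ K := by positivity
  have hc5 : |t₁ * t₂ - x₅| ≤ c * |x₅| := abs_mul_sub_le_of_rel hu0.le h₁ h₂ h₅
  have hc6 : |t₃ * t₄ - x₆| ≤ c * |x₆| := abs_mul_sub_le_of_rel hu0.le h₃ h₄ h₆
  -- `|t_A − A| ≤ ε|A| + c·s`
  have herr : |(t₁ * t₂ - t₃ * t₄) - A| ≤ u * |A| + c * s := by
    have hdec : (t₁ * t₂ - t₃ * t₄) - A = (t₁ * t₂ - x₅) - (t₃ * t₄ - x₆) + ((x₅ - x₆) - A) := by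
      ring
    rw [hdec]
    calc |(t₁ * t₂ - x₅) - (t₃ * t₄ - x₆) + ((x₅ - x₆) - A)|
          ≤ |(t₁ * t₂ - x₅) - (t₃ * t₄ - x₆)| + |(x₅ - x₆) - A| := abs_add_le _ _
      _ ≤ |t₁ * t₂ - x₅| + |t₃ * t₄ - x₆| + |(x₅ - x₆) - A| := by
          linarith [abs_sub (t₁ * t₂ - x₅) (t₃ * t₄ - x₆)]
      _ ≤ c * |x₅| + c * |x₆| + u * |A| := by linarith
      _ = u * |A| + c * s := by rw [hs_def]; ring
  -- the computed bound: `S ≥ (1 − ε)s`, `E ≥ (1 − ε)KS`, hence `|A| ≥ (1 − ε)²Ks`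
  have hS1 : (1 - u) * s ≤ S := by
    have := (abs_sub_le_iff.mp hS).1
    linarith
  have hS0 : 0 ≤ S := le_trans (by nlinarith) hS1
  have hE1 : (1 - u) * (K * S) ≤ E := by
    have h := (abs_sub_le_iff.mp hE).1
    have : (3 + 16 * u) * u * S = K * S := by rw [hK_def]
    rw [this] at h
    linarith
  have hA1 : (1 - u) ^ 2 * K * s ≤ |A| := by
    have h1u : 0 ≤ 1 - u := by linarith
    calc (1 - u) ^ 2 * K * s = (1 - u) * (K * ((1 - u) * s)) := by ring
      _ ≤ (1 - u) * (K * S) := mul_le_mul_of_nonneg_left (mul_le_mul_of_nonneg_left hS1 hK0) h1u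
      _ ≤ E := hE1
      _ ≤ |A| := htest
  -- the margin `(1 − ε)³K − c = ε(4 − 40ε + 45ε² − 16ε³) > 0`
  have hmargin : c * s < (1 - u) * |A| := by
    have hpoly : 0 < 4 - 40 * u + 45 * u ^ 2 - 16 * u ^ 3 := by nlinarith
    have hkey : (1 - u) ^ 3 * K - c = u ^ 2 * (4 - 40 * u + 45 * u ^ 2 - 16 * u ^ 3) := by
      rw [hK_def, hc_def]; ring
    have hlt : c < (1 - u) ^ 3 * K := by
      have := mul_pos (pow_pos hu0 2) hpoly
      rw [← hkey] at this
      linarith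
    have h1u : 0 ≤ 1 - u := by linarith
    calc c * s < (1 - u) ^ 3 * K * s := mul_lt_mul_of_pos_right hlt hs
      _ = (1 - u) * ((1 - u) ^ 2 * K * s) := by ring
      _ ≤ (1 - u) * |A| := mul_le_mul_of_nonneg_left hA1 h1u
  have hstrict : |(t₁ * t₂ - t₃ * t₄) - A| < |A| := by linarith
  -- sign conclusions
  obtain ⟨hl, hr⟩ := abs_sub_lt_iff.mp hstrict
  constructor
  · constructor
    · intro hApos
      rw [abs_of_pos hApos] at hr
      linarith
    · intro htpos
      by_contra hle
      push Not at hle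
      rcases hle.lt_or_eq with hneg | hzero
      · rw [abs_of_neg hneg] at hl
        linarith
      · rw [hzero, abs_zero] at hstrict
        exact absurd hstrict (not_lt.mpr (abs_nonneg _))
  · constructor
    · intro hAneg
      rw [abs_of_neg hAneg] at hl
      linarith
    · intro htneg
      by_contra hle
      push Not at hle
      rcases hle.lt_or_eq with hpos | hzero
      · rw [abs_of_pos hpos] at hr
        linarith
      · rw [← hzero, abs_zero] at hstrict
        exact absurd hstrict (not_lt.mpr (abs_nonneg _))

/-! ## Stage A of ORIENT2D -/

/-- The coefficient `ccwerrboundA = (3 + 16ε)ε` of Table 1, line A (`ε = 2^−p`; `predicates.c`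
`exactinit`: `ccwerrboundA = (3.0 + 16.0 * epsilon) * epsilon`, computed exactly).
[cite: Shewchuk1997, §4.3 Table 1 p. 349] -/
def ccwerrboundA (p : ℕ) : ℚ := (3 + 16 * unitRoundoff p) * unitRoundoff p

/-- `ccwerrboundA = (3·2^p + 16)·2^(−2p)` lies on the grid `2^(−2p) ℤ`.
[cite: Shewchuk1997, §4.3 Table 1 p. 349] -/
theorem onGrid_ccwerrboundA (p : ℕ) : OnGrid (-(2 * (p : ℤ))) (ccwerrboundA p) := by
  refine ⟨3 * 2 ^ p + 16, ?_⟩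
  unfold ccwerrboundA unitRoundoff
  have h2 : (2 : ℚ) ^ p ≠ 0 := pow_ne_zero _ (by norm_num)
  rw [show (-(2 * (p : ℤ))) = -((p : ℤ) + (p : ℤ)) by ring, zpow_neg, zpow_add₀ (by norm_num),
    zpow_natCast]
  push_cast
  field_simp

/-- **Stage A of ORIENT2D** (Fig. 21, top; `predicates.c` function `orient2d`), over a rounding `fl`
and a bound coefficient `K`: `detleft ⇐ (a_x ⊖ c_x) ⊗ (b_y ⊖ c_y)`, `detright ⇐ (a_y ⊖ c_y) ⊗ (b_x ⊖ c_x)`,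
`det ⇐ detleft ⊖ detright`; if `detleft` and `detright` have opposite signs or `detleft = 0`,
return `det`; otherwise `detsum ⇐ |detleft| ⊕ |detright|` (computed as `detleft ⊕ detright` or
`(−detleft) ⊖ detright`), `errbound ⇐ K ⊗ detsum`, and return `det` iff `det ≥ errbound` or
`−det ≥ errbound`.  `some det` = stage A answers; `none` = fall through to `orient2dadapt`.
[cite: Shewchuk1997, §4.3 Fig. 21 p. 347] -/
def orient2dStageA (fl : ℚ → ℚ) (K : ℚ) (a₁ a₂ b₁ b₂ c₁ c₂ : ℚ) : Option ℚ :=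
  let detleft := fl (fl (a₁ - c₁) * fl (b₂ - c₂))
  let detright := fl (fl (a₂ - c₂) * fl (b₁ - c₁))
  let det := fl (detleft - detright)
  if 0 < detleft then
    (if detright ≤ 0 then some det
     else if fl (K * fl (detleft + detright)) ≤ det ∨ fl (K * fl (detleft + detright)) ≤ -det
       then some det else none)
  else if detleft < 0 then
    (if 0 ≤ detright then some det
     else if fl (K * fl (-detleft - detright)) ≤ det ∨ fl (K * fl (-detleft - detright)) ≤ -det
       then some det else none)
  else some det

/-- **THE STAGE-A FILTER OF ORIENT2D IS CORRECT** (Table 1, line A).  Let `p ≥ 4`, `fl` ANY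
round-to-nearest into `F(p, emin)` (any tie-breaking rule), `K = ccwerrboundA p = (3 + 16ε)ε`, and
the six coordinates floats of a format `F(p, e₀)` with `emin ≤ e₀` and `emin + 2p ≤ 2e₀` (so that
every operation of stage A — on the grids `2^e₀ ℤ`, `2^2e₀ ℤ`, `2^(2e₀ − 2p) ℤ` — is exact or
rounds a normal number).  If stage A returns `det`, then `det > 0 ↔ t_A > 0` and `det < 0 ↔ t_A < 0`
for the exact determinant `t_A = (a_x − c_x)(b_y − c_y) − (a_y − c_y)(b_x − c_x)`; in particular
`det = 0 ↔ t_A = 0`. [cite: Shewchuk1997, §4.3 p. 348 and Table 1 p. 349] -/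
theorem orient2dStageA_correct (hp : 4 ≤ p) (hfl : IsRoundNearest p emin fl) {e₀ : ℤ}
    (he₀ : emin ≤ e₀) (h2 : emin + 2 * p ≤ e₀ + e₀) {a₁ a₂ b₁ b₂ c₁ c₂ : ℚ}
    (ha₁ : IsFloat p e₀ a₁) (ha₂ : IsFloat p e₀ a₂) (hb₁ : IsFloat p e₀ b₁) (hb₂ : IsFloat p e₀ b₂)
    (hc₁ : IsFloat p e₀ c₁) (hc₂ : IsFloat p e₀ c₂) {A : ℚ}
    (hA : orient2dStageA fl (ccwerrboundA p) a₁ a₂ b₁ b₂ c₁ c₂ = some A) :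
    (0 < A ↔ 0 < (a₁ - c₁) * (b₂ - c₂) - (a₂ - c₂) * (b₁ - c₁)) ∧
      (A < 0 ↔ (a₁ - c₁) * (b₂ - c₂) - (a₂ - c₂) * (b₁ - c₁) < 0) := by
  have hp1 : 1 ≤ p := le_trans (by norm_num) hp
  have he₂ : emin ≤ e₀ + e₀ := by omega
  have he₃ : emin ≤ e₀ + e₀ + -(2 * (p : ℤ)) := by omega
  set u := unitRoundoff p with hu_def
  have hu0 : 0 < u := by rw [hu_def]; unfold unitRoundoff; positivity
  have hu16 : u ≤ 1 / 16 := BoldoMuller2011.unitRoundoff_le_sixteenth hp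
  -- the quantities of p. 348
  set t₁ := a₁ - c₁ with ht₁
  set t₂ := b₂ - c₂ with ht₂
  set t₃ := a₂ - c₂ with ht₃
  set t₄ := b₁ - c₁ with ht₄
  set x₁ := fl t₁ with hx₁
  set x₂ := fl t₂ with hx₂
  set x₃ := fl t₃ with hx₃
  set x₄ := fl t₄ with hx₄
  set x₅ := fl (x₁ * x₂) with hx₅
  set x₆ := fl (x₃ * x₄) with hx₆
  -- grids
  have gt₁ : OnGrid e₀ t₁ := (OnGrid.of_isFloat ha₁).sub (OnGrid.of_isFloat hc₁)
  have gt₂ : OnGrid e₀ t₂ := (OnGrid.of_isFloat hb₂).sub (OnGrid.of_isFloat hc₂)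
  have gt₃ : OnGrid e₀ t₃ := (OnGrid.of_isFloat ha₂).sub (OnGrid.of_isFloat hc₂)
  have gt₄ : OnGrid e₀ t₄ := (OnGrid.of_isFloat hb₁).sub (OnGrid.of_isFloat hc₁)
  have gx₁ : OnGrid e₀ x₁ := gt₁.fl_of hp1 hfl he₀
  have gx₂ : OnGrid e₀ x₂ := gt₂.fl_of hp1 hfl he₀
  have gx₃ : OnGrid e₀ x₃ := gt₃.fl_of hp1 hfl he₀
  have gx₄ : OnGrid e₀ x₄ := gt₄.fl_of hp1 hfl he₀
  have g₁₂ : OnGrid (e₀ + e₀) (x₁ * x₂) := gx₁.mul gx₂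
  have g₃₄ : OnGrid (e₀ + e₀) (x₃ * x₄) := gx₃.mul gx₄
  have gx₅ : OnGrid (e₀ + e₀) x₅ := g₁₂.fl_of hp1 hfl he₂
  have gx₆ : OnGrid (e₀ + e₀) x₆ := g₃₄.fl_of hp1 hfl he₂
  have g₅₆ : OnGrid (e₀ + e₀) (x₅ - x₆) := gx₅.sub gx₆
  -- signs of the computed values are the signs of the true values
  have s₁ : (0 < x₁ ↔ 0 < t₁) ∧ (x₁ < 0 ↔ t₁ < 0) :=
    ⟨fl_pos_iff_of_onGrid hp1 hfl he₀ gt₁, fl_neg_iff_of_onGrid hp1 hfl he₀ gt₁⟩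
  have s₂ : (0 < x₂ ↔ 0 < t₂) ∧ (x₂ < 0 ↔ t₂ < 0) :=
    ⟨fl_pos_iff_of_onGrid hp1 hfl he₀ gt₂, fl_neg_iff_of_onGrid hp1 hfl he₀ gt₂⟩
  have s₃ : (0 < x₃ ↔ 0 < t₃) ∧ (x₃ < 0 ↔ t₃ < 0) :=
    ⟨fl_pos_iff_of_onGrid hp1 hfl he₀ gt₃, fl_neg_iff_of_onGrid hp1 hfl he₀ gt₃⟩
  have s₄ : (0 < x₄ ↔ 0 < t₄) ∧ (x₄ < 0 ↔ t₄ < 0) :=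
    ⟨fl_pos_iff_of_onGrid hp1 hfl he₀ gt₄, fl_neg_iff_of_onGrid hp1 hfl he₀ gt₄⟩
  have s₅ : (0 < x₅ ↔ 0 < x₁ * x₂) ∧ (x₅ < 0 ↔ x₁ * x₂ < 0) :=
    ⟨fl_pos_iff_of_onGrid hp1 hfl he₂ g₁₂, fl_neg_iff_of_onGrid hp1 hfl he₂ g₁₂⟩
  have s₆ : (0 < x₆ ↔ 0 < x₃ * x₄) ∧ (x₆ < 0 ↔ x₃ * x₄ < 0) :=
    ⟨fl_pos_iff_of_onGrid hp1 hfl he₂ g₃₄, fl_neg_iff_of_onGrid hp1 hfl he₂ g₃₄⟩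
  have sA : (0 < fl (x₅ - x₆) ↔ 0 < x₅ - x₆) ∧ (fl (x₅ - x₆) < 0 ↔ x₅ - x₆ < 0) :=
    ⟨fl_pos_iff_of_onGrid hp1 hfl he₂ g₅₆, fl_neg_iff_of_onGrid hp1 hfl he₂ g₅₆⟩
  -- sign of a product from the signs of its factors (`t₁t₂` vs `x₁x₂`, `t₃t₄` vs `x₃x₄`)
  have prod_signs : ∀ {y₁ y₂ z₁ z₂ : ℚ}, ((0 < y₁ ↔ 0 < z₁) ∧ (y₁ < 0 ↔ z₁ < 0)) →
      ((0 < y₂ ↔ 0 < z₂) ∧ (y₂ < 0 ↔ z₂ < 0)) →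
      ((0 < y₁ * y₂ ↔ 0 < z₁ * z₂) ∧ (y₁ * y₂ < 0 ↔ z₁ * z₂ < 0)) := by
    intro y₁ y₂ z₁ z₂ hy hz
    have e1 : (0 < y₁ ↔ 0 < z₁) := hy.1
    have e2 : (y₁ < 0 ↔ z₁ < 0) := hy.2
    have e3 : (0 < y₂ ↔ 0 < z₂) := hz.1
    have e4 : (y₂ < 0 ↔ z₂ < 0) := hz.2
    have ez1 : y₁ = 0 ↔ z₁ = 0 := by
      constructor
      · intro h; rcases lt_trichotomy z₁ 0 with h' | h' | h'
        · exact absurd (e2.mpr h') (by rw [h]; exact lt_irrefl 0)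
        · exact h'
        · exact absurd (e1.mpr h') (by rw [h]; exact lt_irrefl 0)
      · intro h; rcases lt_trichotomy y₁ 0 with h' | h' | h'
        · exact absurd (e2.mp h') (by rw [h]; exact lt_irrefl 0)
        · exact h'
        · exact absurd (e1.mp h') (by rw [h]; exact lt_irrefl 0)
    have ez2 : y₂ = 0 ↔ z₂ = 0 := by
      constructor
      · intro h; rcases lt_trichotomy z₂ 0 with h' | h' | h'
        · exact absurd (e4.mpr h') (by rw [h]; exact lt_irrefl 0)
        · exact h'
        · exact absurd (e3.mpr h') (by rw [h]; exact lt_irrefl 0)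
      · intro h; rcases lt_trichotomy y₂ 0 with h' | h' | h'
        · exact absurd (e4.mp h') (by rw [h]; exact lt_irrefl 0)
        · exact h'
        · exact absurd (e3.mp h') (by rw [h]; exact lt_irrefl 0)
    rcases lt_trichotomy y₁ 0 with h1 | h1 | h1 <;> rcases lt_trichotomy y₂ 0 with h2' | h2' | h2'
    · have := e2.mp h1; have := e4.mp h2'
      exact ⟨⟨fun _ => by nlinarith, fun _ => by nlinarith⟩,
        ⟨fun h => by nlinarith, fun h => by nlinarith⟩⟩
    · have hz2 := ez2.mp h2'; subst h2'; rw [hz2]; simp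
    · have := e2.mp h1; have := e3.mp h2'
      exact ⟨⟨fun h => by nlinarith, fun h => by nlinarith⟩,
        ⟨fun _ => by nlinarith, fun _ => by nlinarith⟩⟩
    · have hz1 := ez1.mp h1; subst h1; rw [hz1]; simp
    · have hz1 := ez1.mp h1; subst h1; rw [hz1]; simp
    · have hz1 := ez1.mp h1; subst h1; rw [hz1]; simp
    · have := e1.mp h1; have := e4.mp h2'
      exact ⟨⟨fun h => by nlinarith, fun h => by nlinarith⟩,
        ⟨fun _ => by nlinarith, fun _ => by nlinarith⟩⟩
    · have hz2 := ez2.mp h2'; subst h2'; rw [hz2]; simp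
    · have := e1.mp h1; have := e3.mp h2'
      exact ⟨⟨fun _ => by nlinarith, fun _ => by nlinarith⟩,
        ⟨fun h => by nlinarith, fun h => by nlinarith⟩⟩
  have p₅ : (0 < x₅ ↔ 0 < t₁ * t₂) ∧ (x₅ < 0 ↔ t₁ * t₂ < 0) := by
    have h := prod_signs s₁ s₂
    exact ⟨s₅.1.trans h.1, s₅.2.trans h.2⟩
  have p₆ : (0 < x₆ ↔ 0 < t₃ * t₄) ∧ (x₆ < 0 ↔ t₃ * t₄ < 0) := by
    have h := prod_signs s₃ s₄
    exact ⟨s₆.1.trans h.1, s₆.2.trans h.2⟩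
  -- the filtered case, for either sign of `detleft`
  have filtered : ∀ {S : ℚ}, |(|x₅| + |x₆|) - S| ≤ u * (|x₅| + |x₆|) → OnGrid (e₀ + e₀) S →
      0 < |x₅| + |x₆| →
      (fl (ccwerrboundA p * S) ≤ fl (x₅ - x₆) ∨ fl (ccwerrboundA p * S) ≤ -fl (x₅ - x₆)) →
      (0 < fl (x₅ - x₆) ↔ 0 < t₁ * t₂ - t₃ * t₄) ∧ (fl (x₅ - x₆) < 0 ↔ t₁ * t₂ - t₃ * t₄ < 0) := by
    intro S hS gS hs htest
    have gKS : OnGrid (-(2 * (p : ℤ)) + (e₀ + e₀)) (ccwerrboundA p * S) :=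
      (onGrid_ccwerrboundA p).mul gS
    have hE : |ccwerrboundA p * S - fl (ccwerrboundA p * S)| ≤ u * |ccwerrboundA p * S| :=
      abs_sub_fl_le_eps_mul_abs hp1 hfl (by omega) gKS
    have hS0 : 0 ≤ S := by
      have := (abs_sub_le_iff.mp hS).1
      nlinarith [abs_nonneg x₅, abs_nonneg x₆]
    have hKS0 : 0 ≤ ccwerrboundA p * S := mul_nonneg (by unfold ccwerrboundA; positivity) hS0
    rw [abs_of_nonneg hKS0] at hE
    have hE' : |(3 + 16 * u) * u * S - fl (ccwerrboundA p * S)| ≤ u * ((3 + 16 * u) * u * S) := by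
      have : (3 + 16 * u) * u * S = ccwerrboundA p * S := by rw [hu_def]; unfold ccwerrboundA; ring
      rw [this]; exact hE
    have htest' : fl (ccwerrboundA p * S) ≤ |fl (x₅ - x₆)| := by
      rcases htest with h | h
      · exact h.trans (le_abs_self _)
      · exact h.trans (neg_le_abs _)
    exact stageA_sign_of_bounds hu0 hu16
      (abs_sub_fl_le_eps_mul_abs_fl hp1 hfl he₀ gt₁) (abs_sub_fl_le_eps_mul_abs_fl hp1 hfl he₀ gt₂)
      (abs_sub_fl_le_eps_mul_abs_fl hp1 hfl he₀ gt₃) (abs_sub_fl_le_eps_mul_abs_fl hp1 hfl he₀ gt₄)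
      (abs_sub_fl_le_eps_mul_abs_fl hp1 hfl he₂ g₁₂) (abs_sub_fl_le_eps_mul_abs_fl hp1 hfl he₂ g₃₄)
      (abs_sub_fl_le_eps_mul_abs_fl hp1 hfl he₂ g₅₆) hS hE' hs htest'
  -- case analysis along the branches of stage A
  unfold orient2dStageA at hA
  simp only [] at hA
  rw [← ht₁, ← ht₂, ← ht₃, ← ht₄, ← hx₁, ← hx₂, ← hx₃, ← hx₄, ← hx₅, ← hx₆] at hA
  split_ifs at hA with hL hR hT hL' hR' hT'
  · -- `detleft > 0`, `detright ≤ 0`: both `det` and `t_A` are positive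
    obtain rfl := Option.some.inj hA
    have ht5 : 0 < t₁ * t₂ := p₅.1.mp hL
    have ht6 : t₃ * t₄ ≤ 0 := by
      rcases hR.lt_or_eq with h | h
      · exact (p₆.2.mp h).le
      · have : x₃ * x₄ = 0 := (fl_eq_zero_iff_of_onGrid hp1 hfl he₂ g₃₄).mp h
        rcases mul_eq_zero.mp this with h0 | h0
        · have : t₃ = 0 := (fl_eq_zero_iff_of_onGrid hp1 hfl he₀ gt₃).mp h0
          rw [this, zero_mul]
        · have : t₄ = 0 := (fl_eq_zero_iff_of_onGrid hp1 hfl he₀ gt₄).mp h0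
          rw [this, mul_zero]
    have hdet : 0 < fl (x₅ - x₆) := sA.1.mpr (by linarith)
    have htA : 0 < t₁ * t₂ - t₃ * t₄ := by linarith
    exact ⟨⟨fun _ => htA, fun _ => hdet⟩,
      ⟨fun h => absurd h (not_lt.mpr hdet.le), fun h => absurd h (not_lt.mpr htA.le)⟩⟩
  · -- `detleft > 0`, `detright > 0`, test passed with `detsum = detleft ⊕ detright`
    obtain rfl := Option.some.inj hA
    have hR : 0 < x₆ := not_le.mp hR
    have hsum : x₅ + x₆ = |x₅| + |x₆| := by rw [abs_of_pos hL, abs_of_pos hR]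
    have gS : OnGrid (e₀ + e₀) (fl (x₅ + x₆)) := (gx₅.add gx₆).fl_of hp1 hfl he₂
    have hS : |(|x₅| + |x₆|) - fl (x₅ + x₆)| ≤ u * (|x₅| + |x₆|) := by
      have h := abs_sub_fl_le_eps_mul_abs hp1 hfl he₂ (gx₅.add gx₆)
      rw [← hsum]
      rwa [abs_of_pos (by linarith : (0 : ℚ) < x₅ + x₆)] at h
    exact filtered hS gS (by positivity) hT
  · -- `detleft < 0`, `detright ≥ 0`: both negative
    obtain rfl := Option.some.inj hA
    have ht5 : t₁ * t₂ < 0 := p₅.2.mp hL'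
    have ht6 : 0 ≤ t₃ * t₄ := by
      rcases hR'.lt_or_eq with h | h
      · exact (p₆.1.mp h).le
      · have : x₃ * x₄ = 0 := (fl_eq_zero_iff_of_onGrid hp1 hfl he₂ g₃₄).mp h.symm
        rcases mul_eq_zero.mp this with h0 | h0
        · have : t₃ = 0 := (fl_eq_zero_iff_of_onGrid hp1 hfl he₀ gt₃).mp h0
          rw [this, zero_mul]
        · have : t₄ = 0 := (fl_eq_zero_iff_of_onGrid hp1 hfl he₀ gt₄).mp h0
          rw [this, mul_zero]
    have hdet : fl (x₅ - x₆) < 0 := sA.2.mpr (by linarith)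
    have htA : t₁ * t₂ - t₃ * t₄ < 0 := by linarith
    exact ⟨⟨fun h => absurd h (not_lt.mpr hdet.le), fun h => absurd h (not_lt.mpr htA.le)⟩,
      ⟨fun _ => htA, fun _ => hdet⟩⟩
  · -- `detleft < 0`, `detright < 0`, test passed with `detsum = (−detleft) ⊖ detright`
    obtain rfl := Option.some.inj hA
    have hR' : x₆ < 0 := not_le.mp hR'
    have hsum : -x₅ - x₆ = |x₅| + |x₆| := by rw [abs_of_neg hL', abs_of_neg hR']; ring
    have gS : OnGrid (e₀ + e₀) (fl (-x₅ - x₆)) := (gx₅.neg.sub gx₆).fl_of hp1 hfl he₂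
    have hS : |(|x₅| + |x₆|) - fl (-x₅ - x₆)| ≤ u * (|x₅| + |x₆|) := by
      have h := abs_sub_fl_le_eps_mul_abs hp1 hfl he₂ (gx₅.neg.sub gx₆)
      rw [← hsum]
      rwa [abs_of_pos (by linarith : (0 : ℚ) < -x₅ - x₆)] at h
    have hpos : 0 < |x₅| + |x₆| := by
      have := abs_pos.mpr hL'.ne; positivity
    exact filtered hS gS hpos hT'
  · -- `detleft = 0`: `det = ⊖detright` exactly, `t₅ = 0`
    obtain rfl := Option.some.inj hA
    have hx5 : x₅ = 0 := le_antisymm (not_lt.mp hL) (not_lt.mp hL')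
    have ht5 : t₁ * t₂ = 0 := by
      have : x₁ * x₂ = 0 := (fl_eq_zero_iff_of_onGrid hp1 hfl he₂ g₁₂).mp (by rw [← hx₅]; exact hx5)
      rcases mul_eq_zero.mp this with h0 | h0
      · have : t₁ = 0 := (fl_eq_zero_iff_of_onGrid hp1 hfl he₀ gt₁).mp h0
        rw [this, zero_mul]
      · have : t₂ = 0 := (fl_eq_zero_iff_of_onGrid hp1 hfl he₀ gt₂).mp h0
        rw [this, mul_zero]
    rw [ht5, zero_sub]
    constructor
    · rw [sA.1, hx5, zero_sub, neg_pos, neg_pos]; exact p₆.2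
    · rw [sA.2, hx5, zero_sub, neg_lt_zero, neg_lt_zero]; exact p₆.1

end Literature.ComputerArithmetic.Shewchuk1997
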